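import Literature.MathematicalPhysics.QuantumFieldTheory.Dimock2011to13.RandomWalkExpansion

/-!
# Dimock, *The renormalization group according to Balaban* I, §2.5 "decoupling": the weights `s_ω = Π_{□⊂X_ω}s_□` on the
# random walk expansion and the weakened Green's function `G_k(s) = Σ_ω s_ω G_{k,ω}` — `G_k(1) = G_k`, `G_k(0) = G*_k`, the
# majorant `|s_ω| ≤ R^{|X_ω|_M}`, absolute convergence, and the support mechanism of §4.5's localization lemma — PROVED
# on the operator-ring skeleton of `RandomWalkExpansion`

**Citation header (reproduction of PUBLISHED work; template of the Bałaban lattice Yang–Mills cell).**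
J. Dimock, *The renormalization group according to Balaban I. Small fields*, Rev. Math. Phys. **25** (2013) 1330010
(= arXiv:1108.1335v2) [Dimock2013], §2.5 "decoupling" (`\label{decoupling}`) TeX L1091–1130 (the weights L1095–1103, (rws)
L1106–1118, the complex domain L1126–1130); §4.5 "localization" L2345–2351 ((again)), L2410–2416 (the support argument of
the localization lemma) and L2445–2453 (the domain `|s_□| ≤ M^{1/2}`, `κ₁ = ½ log M`); §2.4 (sonic) L1055–1064.  TeX line
numbers refer to the arXiv source held by the cell (`inputs/files/dimock/src/1108.1335/1108.1335.tex`); every quotation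
below was read there this session.  Dimock's papers are published and refereed and are the cell's TEMPLATE, not
manuscripts under audit; no quantity of the Bałaban series is touched.

**What the paper prints (verbatim).**  L1092–1103: *"We also we need a version of G_k in which the communication between
sites is systematically weakened. For each M-cube □ introduce a variable s_□ with 0 ≤ s_□ ≤ 1. Then define for ω = (ω_0,
ω_1, …, ω_n)  s_ω = Π_{□⊂X_ω} s_□,  X_ω = ⋃_{j=1}^n □̃_{ω_j}  Note that □̃_{ω_0} is omitted from X_ω. Hence if ω is only a
single point ω_0 (i.e. |ω|=0) then X_ω is empty and in this case we set s_ω = 1."*  (rws) L1106–1120: *"Now we define for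
s = {s_□}  G_k(s) = Σ_ω s_ω G_{k,ω}  Then we have G_k(1) = Σ_ω G_{k,ω} = G_k,  G_k(0) = Σ_{ω:|ω|=1} G_{k,ω} = G*_k  Thus G_k(s)
interpolates between an operator for which all sites are coupled and an operator for which keeps thing localized in each
cube □̃."*  L1126–1130: *"Note that G_k(s) can be defined and bounded for s_□ complex and in a much large domain. We can take
for example |s_□| ≤ M^{1/2}. Then in (sonic) instead of (CM^{−1})^n we have (C|s_□|M^{−1})^n ≤ (CM^{−1/2})^n. The random
walk expansion still converges if M is sufficiently large."*  §4.5 L2410–2414: *"If □ ⊂ Z^c then s_□ = 0 and so then s_ω = 0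
for any path ω such that X_ω ⊃ □. Thus in G_k(s)|_{s_{Z^c}=0} paths such that X_ω intersect Z^c do not occur, and we must
have X_ω ⊂ Z."*

**What is reproduced here (kernel-checked, zero `sorry`).**  On the skeleton of `…Dimock2011to13.RandomWalkExpansion`
(operators in a ring `R`, blocks `z ∈ Z`, `walkTerm A H G z₀ ω = (h_{ω_0}G_k(□̃_{ω_0})h_{ω_0})(K_{ω_1}G_k(□̃_{ω_1})h_{ω_1})⋯`
for `ω : Fin n → Z` the steps `ω_1, …, ω_n`), with the `M`-cubes `□ ∈ C` of each block given by `cubes : Z → Finset C`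
(print: the `3^d` `M`-cubes of `□̃_z`):
* §1 THE WEIGHTS, VERBATIM: `Xω cubes ω = ⋃_{j} cubes (ω j)` (= `X_ω`, `□̃_{ω_0}` omitted), `sω cubes s ω = Π_{□∈X_ω} s □`;
  `sω_len_zero` (*"|ω|=0 … X_ω is empty and … s_ω = 1"*), `sω_one` (`s ≡ 1 ⟹ s_ω = 1`), `sω_zero_of_pos` (`s ≡ 0`, `n ≥ 1`,
  blocks nonempty ⟹ `s_ω = 0`), **`sω_eq_zero_of_mem`** (*"If □ ⊂ Z^c then s_□ = 0 and so then s_ω = 0 for any path ω such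
  that X_ω ⊃ □"*), `card_Xω_le` (`|X_ω|_M ≤ m·n` when every block has `≤ m` cubes);
* §2 THE MAJORANTS: **`norm_sω_le_one`** (`|s_□| ≤ 1 ⟹ |s_ω| ≤ 1` — the real interpolation of (summer)) and
  **`norm_sω_le_pow`** (`|s_□| ≤ R`, `R ≥ 1` ⟹ `|s_ω| ≤ R^{|X_ω|_M} ≤ R^{m·n}`);
* §3 THE WEAKENED EXPANSION: `level A H G cubes s n = Σ_{ω_0}Σ_{ω : Fin n → Z} s_ω • G_{k,ω}` (the `|ω| = n` part of (rws)),
  `Gs … = Σ'_n level … n` (= `G_k(s)`); **`level_one`** (`s ≡ 1`: `= G*_kK^n`, so `G_k(1) = Σ_n G*_kK^n = G_k` by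
  `RandomWalkExpansion.Gstar_mul_Kop_pow`), **`level_zero_len`**∕**`level_zero_of_pos`**∕**`Gs_zero`** (`G_k(0) = G*_k`);
  **`norm_level_le`** (from the per-length walk-sum bound `Σ_{|ω|=n}‖G_{k,ω}‖ ≤ c₀q^n` — the print's `C(CM^{−1})^n(3^d)^n`,
  hypothesis — and `|s_□| ≤ R`: `‖level n‖ ≤ c₀(R^m q)^n`), **`summable_level`**, **`norm_Gs_le`** (`R^m q < 1 ⟹ G_k(s)`
  converges absolutely, `‖G_k(s)‖ ≤ c₀(1 − R^m q)^{−1}`), `norm_level_le_one`∕`norm_Gs_le_one` (the case `|s_□| ≤ 1`: ratio `q`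
  unchanged);
* §4 THE SUPPORT RESTRICTION of §4.5 (L2410–2414): **`level_eq_sum_filter`** — if `s_□ = 0` off `Zset` then only the walks
  with `X_ω ⊆ Zset` contribute to `G_k(s)`;
* §5 THE ARITHMETIC OF THE COMPLEX DOMAIN: `ratio_rpow_eq` (`(M^α)^m·M^{−1} = M^{mα−1}`), **`ratio_tendsto_zero`** (`mα < 1
  ⟹ c(M^α)^mM^{−1} → 0` as `M → ∞`: the expansion converges for `M` large on `|s_□| ≤ M^α`) and `ratio_tendsto_atTop`
  (`mα > 1`, `c > 0` ⟹ `→ ∞`).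

**Readings ∕ located items (declared).**  (i) ABSTRACT SKELETON as in `RandomWalkExpansion` (readings (i)–(iii) there):
operators in a normed algebra `R` over `𝕜 = ℝ` or `ℂ`, walks = all sequences, the per-length bound `Σ_{|ω|=n}‖G_{k,ω}‖ ≤
c₀q^n` as the hypothesis standing for (sonic)'s `C(CM^{−1})^n(3^d)^n e^{−½γ₀d}` (sup-norm form, decay factor dropped).
(ii) `|ω|`: the print writes *"i.e. |ω|=0"* for a single point (L1102) and *"Σ_{ω:|ω|=1}"* in `G_k(0)` (L1116) — with `|ω| =
n` for `(ω_0, …, ω_n)` (L947) the latter is the `|ω| = 0` part; the module's `level … 0` is that part (records only).  (iii)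
INFO, records only (a located COUNT, not an objection to any statement of the paper): with the printed DEFINITION `s_ω =
Π_{□⊂X_ω}s_□` the weight carries one factor per `M`-cube of `X_ω = ⋃_{j≥1}□̃_{ω_j}` — up to `m = 3^d` per step — so the
majorant the definition supports on `|s_□| ≤ R` (`R ≥ 1`) is `R^{|X_ω|_M} ≤ R^{m·n}` (`norm_sω_le_pow`), and the convergence
ratio is `R^m·q`; the printed *"(C|s_□|M^{−1})^n"* (L1128) is the case of ONE factor per step.  For the real interpolation
`0 ≤ s_□ ≤ 1` (the use in (summer), §4.5) nothing changes (`norm_sω_le_one`).  For the complex Cauchy domain the example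
`|s_□| ≤ M^{1/2}` (L1127; `κ₁ = ½ log M`, L2453) gives the ratio `C·3^d·M^{m/2−1}`, which does not tend to `0` for `m ≥ 2`
(`ratio_tendsto_atTop`), while `|s_□| ≤ M^α` with `mα < 1` does (`ratio_tendsto_zero`) — e.g. `κ₁ = (log M)/(2m)`, still
`→ ∞` with `M`; the proof of LEMMA 19 (snort) uses `κ₁` only through *"We can assume κ₁ − 1 ≥ κ′"* (L2459), which any
`κ₁ → ∞` supplies for `M` large, so LEMMA 19's statement is unaffected.  The same per-step reading recurs in [Dimock2020]
(arXiv:1712.10029) L1663 (*"|s_□| ≤ M^{α_0} for α_0 < 1. This still leaves a convergence factor of M^{−(1−α_0)}"*).  The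
module records the arithmetic and adjudicates nothing further.

**What is NOT claimed.**  The analytic content of LEMMA 6 ((sycamore), App. D, the `K_z` bound), the count `(3^d)^n` and
the decay `e^{−½γ₀d(y,y′)}` (all inside the hypothesis `c₀q^n`); analyticity of `G_k(s)` in `s`; the bounds (gk), (gk2) for
`G_k(s)`; `C_k^{1/2}(s)`, `𝒲_k(s)` (§4.5); anything of B1–B16 (TEMPLATE.md §4.1 row «D1 §2.5» ↔ B13 §1 (1.9)–(1.10) s-cut
expansions, B9 Thm 3.10 — grade T there; untouched).  NOT summit progress; NOT a statement about any Bałaban paper; NOT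
continuum; NOT Clay.  NEW leaf; imports `…Dimock2011to13.RandomWalkExpansion` (this lineage) only; sub-namespace
`…Dimock2011to13.DecouplingWeights`; modifies nothing.  Unit `b2b-balaban-template` gen 32 (journal CLAIM
D1-DECOUPLING-KERNEL); cell records TEMPLATE.md §4.1 row «D1 §2.5», §15.2; GAPS C-tmpl32-3.
-/

noncomputable section

open Finset Filter Topology
open scoped BigOperators

namespace Literature.MathematicalPhysics.QuantumFieldTheory.Dimock2011to13.DecouplingWeights

open RandomWalkExpansion (walkTerm walkTail Gstar Kop Kz Gstar_mul_Kop_pow)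

/-! ## §1 The weights `s_ω` (L1095–1103) -/

section Weights

variable {C : Type*} [DecidableEq C] {Z : Type*} {𝕜 : Type*} [CommMonoidWithZero 𝕜]

/-- `X_ω = ⋃_{j=1}^n □̃_{ω_j}` as a set of `M`-cubes (`cubes z` = the `M`-cubes of the block `□̃_z`; `□̃_{ω_0}` is omitted —
`ω : Fin n → Z` lists the steps `ω_1, …, ω_n` only). [cite: Dimock2013, §2.5 (arXiv:1108.1335v2 TeX L1095–1101)] -/
def Xω (cubes : Z → Finset C) {n : ℕ} (ω : Fin n → Z) : Finset C :=
  Finset.univ.biUnion fun j => cubes (ω j)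

/-- `s_ω = Π_{□⊂X_ω} s_□`, verbatim. [cite: Dimock2013, §2.5 (arXiv:1108.1335v2 TeX L1095–1099)] -/
def sω (cubes : Z → Finset C) (s : C → 𝕜) {n : ℕ} (ω : Fin n → Z) : 𝕜 :=
  ∏ b ∈ Xω cubes ω, s b

omit [CommMonoidWithZero 𝕜] in
/-- membership in `X_ω`: `□ ⊂ X_ω` iff `□ ⊂ □̃_{ω_j}` for some step `j`. [cite: Dimock2013, §2.5 (arXiv:1108.1335v2 TeX
L1095–1101)] -/
theorem mem_Xω {cubes : Z → Finset C} {n : ℕ} {ω : Fin n → Z} {b : C} :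
    b ∈ Xω cubes ω ↔ ∃ j, b ∈ cubes (ω j) := by
  simp [Xω]

omit [CommMonoidWithZero 𝕜] in
/-- *"if ω is only a single point ω_0 (i.e. |ω|=0) then X_ω is empty"*. [cite: Dimock2013, §2.5 (arXiv:1108.1335v2 TeX
L1101–1103)] -/
theorem Xω_len_zero (cubes : Z → Finset C) (ω : Fin 0 → Z) : Xω cubes ω = ∅ := by
  simp [Xω]

/-- *"… and in this case we set s_ω = 1"* — here a consequence of the empty product. [cite: Dimock2013, §2.5
(arXiv:1108.1335v2 TeX L1101–1103)] -/
theorem sω_len_zero (cubes : Z → Finset C) (s : C → 𝕜) (ω : Fin 0 → Z) : sω cubes s ω = 1 := by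
  simp [sω, Xω_len_zero]

/-- `s ≡ 1 ⟹ s_ω = 1` (the point `G_k(1)`). [cite: Dimock2013, §2.5 eq. (rws) (arXiv:1108.1335v2 TeX L1106–1118)] -/
theorem sω_one (cubes : Z → Finset C) {n : ℕ} (ω : Fin n → Z) : sω cubes (fun _ => (1 : 𝕜)) ω = 1 := by
  simp [sω]

/-- **"If □ ⊂ Z^c then s_□ = 0 and so then s_ω = 0 for any path ω such that X_ω ⊃ □"** (L2411–2413). [cite: Dimock2013,
§4.5 (arXiv:1108.1335v2 TeX L2410–2414)] -/
theorem sω_eq_zero_of_mem {cubes : Z → Finset C} {s : C → 𝕜} {n : ℕ} {ω : Fin n → Z} {b : C}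
    (hb : b ∈ Xω cubes ω) (hs : s b = 0) : sω cubes s ω = 0 :=
  Finset.prod_eq_zero hb hs

/-- `s ≡ 0 ⟹ s_ω = 0` for every walk with at least one step (blocks being nonempty) — the point `G_k(0)`. [cite: Dimock2013,
§2.5 eq. (rws) (arXiv:1108.1335v2 TeX L1106–1118)] -/
theorem sω_zero_of_pos {cubes : Z → Finset C} (hne : ∀ z, (cubes z).Nonempty) {n : ℕ} (hn : 0 < n)
    (ω : Fin n → Z) : sω cubes (fun _ => (0 : 𝕜)) ω = 0 := by
  obtain ⟨b, hb⟩ := hne (ω ⟨0, hn⟩)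
  exact sω_eq_zero_of_mem (mem_Xω.2 ⟨⟨0, hn⟩, hb⟩) rfl

omit [CommMonoidWithZero 𝕜] in
/-- `|X_ω|_M ≤ m·n` when every block `□̃_z` consists of at most `m` cubes (print: `m = 3^d`). [cite: Dimock2013, §2.5
(arXiv:1108.1335v2 TeX L1095–1101)] -/
theorem card_Xω_le {cubes : Z → Finset C} {m : ℕ} (hm : ∀ z, (cubes z).card ≤ m) {n : ℕ} (ω : Fin n → Z) :
    (Xω cubes ω).card ≤ m * n := by
  unfold Xω
  calc (Finset.univ.biUnion fun j => cubes (ω j)).card ≤ ∑ j : Fin n, (cubes (ω j)).card := Finset.card_biUnion_le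
    _ ≤ ∑ _j : Fin n, m := Finset.sum_le_sum fun j _ => hm (ω j)
    _ = m * n := by simp [mul_comm]

end Weights

/-! ## §2 The majorants of `|s_ω|` -/

section Majorants

variable {C : Type*} [DecidableEq C] {Z : Type*} {𝕜 : Type*} [NormedField 𝕜]

/-- **the real interpolation**: `|s_□| ≤ 1` for all cubes ⟹ `|s_ω| ≤ 1` (the case `0 ≤ s_□ ≤ 1` of (summer)).
[cite: Dimock2013, §2.5 (arXiv:1108.1335v2 TeX L1095–1099) and §4.5 (TeX L2376–2390)] -/
theorem norm_sω_le_one {cubes : Z → Finset C} {s : C → 𝕜} (hs : ∀ b, ‖s b‖ ≤ 1) {n : ℕ} (ω : Fin n → Z) :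
    ‖sω cubes s ω‖ ≤ 1 := by
  unfold sω
  rw [norm_prod]
  exact Finset.prod_le_one (fun b _ => norm_nonneg _) fun b _ => hs b

/-- **the complex domain**: `|s_□| ≤ R` (`R ≥ 1`) ⟹ `|s_ω| ≤ R^{|X_ω|_M} ≤ R^{m·n}` — ONE FACTOR PER CUBE of `X_ω` (reading
(iii) of the module header: the printed *"(C|s_□|M^{−1})^n"* is one factor per step). [cite: Dimock2013, §2.5
(arXiv:1108.1335v2 TeX L1095–1099, L1126–1130)] -/
theorem norm_sω_le_pow {cubes : Z → Finset C} {s : C → 𝕜} {Rw : ℝ} (hs : ∀ b, ‖s b‖ ≤ Rw) (hR : 1 ≤ Rw)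
    {m : ℕ} (hm : ∀ z, (cubes z).card ≤ m) {n : ℕ} (ω : Fin n → Z) :
    ‖sω cubes s ω‖ ≤ Rw ^ (m * n) := by
  unfold sω
  rw [norm_prod]
  calc ∏ b ∈ Xω cubes ω, ‖s b‖ ≤ ∏ _b ∈ Xω cubes ω, Rw :=
        Finset.prod_le_prod (fun b _ => norm_nonneg _) fun b _ => hs b
    _ = Rw ^ (Xω cubes ω).card := by simp
    _ ≤ Rw ^ (m * n) := pow_le_pow_right₀ hR (card_Xω_le hm ω)

end Majorants

/-! ## §3 The weakened expansion `G_k(s) = Σ_ω s_ω G_{k,ω}` (rws) -/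

section Weakened

variable {C : Type*} [DecidableEq C] {Z : Type*} [Fintype Z] {𝕜 : Type*} [NormedField 𝕜]
  {R : Type*} [NormedRing R] [NormedAlgebra 𝕜 R]

/-- the `|ω| = n` part of (rws): `Σ_{ω_0}Σ_{(ω_1,…,ω_n)} s_ω G_{k,ω}`. [cite: Dimock2013, §2.5 eq. (rws) (arXiv:1108.1335v2
TeX L1106–1111)] -/
def level (A : R) (H G : Z → R) (cubes : Z → Finset C) (s : C → 𝕜) (n : ℕ) : R :=
  ∑ z₀, ∑ ω : Fin n → Z, sω cubes s ω • walkTerm A H G z₀ ω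

/-- **`G_k(s) = Σ_ω s_ω G_{k,ω}`** (rws), as the series over the number of steps. [cite: Dimock2013, §2.5 eq. (rws)
(arXiv:1108.1335v2 TeX L1106–1111)] -/
def Gs (A : R) (H G : Z → R) (cubes : Z → Finset C) (s : C → 𝕜) : R :=
  ∑' n, level A H G cubes s n

variable {A : R} {H G : Z → R} {cubes : Z → Finset C}

/-- **`G_k(1)`**: with all weights `1` the `n`-step part is `G*_kK^n`, i.e. `G_k(1) = Σ_ω G_{k,ω} = G_k` (*"G_k(1) = Σ_ω G_{k,ω} =
G_k"*, with `RandomWalkExpansion.Gstar_mul_Kop_pow`∕`expansion_eq_tsum`). [cite: Dimock2013, §2.5 eq. (rws) (arXiv:1108.1335v2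
TeX L1112–1118)] -/
theorem level_one (n : ℕ) : level A H G cubes (fun _ => (1 : 𝕜)) n = Gstar H G * Kop A H G ^ n := by
  simp only [level, sω_one, one_smul, Gstar_mul_Kop_pow]

/-- `G_k(1) = Σ_n G*_kK^n` (the random walk expansion of `G_k`). [cite: Dimock2013, §2.5 eq. (rws) (arXiv:1108.1335v2 TeX
L1112–1118)] -/
theorem Gs_one : Gs A H G cubes (fun _ => (1 : 𝕜)) = ∑' n, Gstar H G * Kop A H G ^ n := by
  simp only [Gs, level_one]

/-- the `|ω| = 0` part is `G*_k = Σ_{ω_0} h_{ω_0}G_k(□̃_{ω_0})h_{ω_0}` for ANY weights (empty product). [cite: Dimock2013, §2.5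
eq. (rws) (arXiv:1108.1335v2 TeX L1101–1103, L1112–1118)] -/
theorem level_zero_len (s : C → 𝕜) : level A H G cubes s 0 = Gstar H G := by
  simp [level, sω_len_zero, walkTerm, walkTail, Gstar]

/-- **`G_k(0)`**: with all weights `0` every part with `n ≥ 1` steps vanishes (blocks nonempty). [cite: Dimock2013, §2.5 eq.
(rws) (arXiv:1108.1335v2 TeX L1112–1118)] -/
theorem level_zero_of_pos (hne : ∀ z, (cubes z).Nonempty) {n : ℕ} (hn : 0 < n) :
    level A H G cubes (fun _ => (0 : 𝕜)) n = 0 := by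
  simp only [level, sω_zero_of_pos hne hn, zero_smul, Finset.sum_const_zero]

/-- **`G_k(0) = G*_k`** (*"an operator … which keeps thing localized in each cube □̃"*; the print's `Σ_{ω:|ω|=1}` is the
single-point part, reading (ii)). [cite: Dimock2013, §2.5 eq. (rws) (arXiv:1108.1335v2 TeX L1112–1120)] -/
theorem Gs_zero (hne : ∀ z, (cubes z).Nonempty) : Gs A H G cubes (fun _ => (0 : 𝕜)) = Gstar H G := by
  unfold Gs
  rw [tsum_eq_single 0]
  · exact level_zero_len _
  · intro n hn
    exact level_zero_of_pos hne (Nat.pos_of_ne_zero hn)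

/-- THE PER-LENGTH WALK-SUM BOUND as a hypothesis shape: `Σ_{ω_0}Σ_{|ω|=n}‖G_{k,ω}‖ ≤ c₀q^n` (print, (sonic): `Σ_{ω:|ω|=n}
C(CM^{−1})^n e^{−½γ₀d}‖f‖_∞ ≤ C(CM^{−1})^n(3^d)^n …`, i.e. `q = 3^d·CM^{−1}` in the sup-norm reading). HYPOTHESIS, not
asserted. [cite: Dimock2013, §2.4 Lemma jupiter proof (sonic) (arXiv:1108.1335v2 TeX L1055–1064)] -/
def WalkSumBound (A : R) (H G : Z → R) (c₀ q : ℝ) : Prop :=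
  ∀ n, ∑ z₀, ∑ ω : Fin n → Z, ‖walkTerm A H G z₀ ω‖ ≤ c₀ * q ^ n

/-- the `n`-step part under a uniform weight majorant `|s_ω| ≤ B`: `‖Σ_{|ω|=n} s_ωG_{k,ω}‖ ≤ B·c₀q^n`. [cite: Dimock2013,
§2.5 (arXiv:1108.1335v2 TeX L1106–1111, L1126–1130)] -/
theorem norm_level_le_of_sω_le {c₀ q B : ℝ} (hW : WalkSumBound A H G c₀ q) (hB0 : 0 ≤ B) {s : C → 𝕜} {n : ℕ}
    (hB : ∀ ω : Fin n → Z, ‖sω cubes s ω‖ ≤ B) : ‖level A H G cubes s n‖ ≤ B * (c₀ * q ^ n) := by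
  unfold level
  calc ‖∑ z₀, ∑ ω : Fin n → Z, sω cubes s ω • walkTerm A H G z₀ ω‖
      ≤ ∑ z₀, ‖∑ ω : Fin n → Z, sω cubes s ω • walkTerm A H G z₀ ω‖ := norm_sum_le _ _
    _ ≤ ∑ z₀, ∑ ω : Fin n → Z, ‖sω cubes s ω • walkTerm A H G z₀ ω‖ :=
        Finset.sum_le_sum fun z₀ _ => norm_sum_le _ _
    _ ≤ ∑ z₀, ∑ ω : Fin n → Z, B * ‖walkTerm A H G z₀ ω‖ := by
        refine Finset.sum_le_sum fun z₀ _ => Finset.sum_le_sum fun ω _ => ?_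
        rw [norm_smul]
        exact mul_le_mul_of_nonneg_right (hB ω) (norm_nonneg _)
    _ = B * ∑ z₀, ∑ ω : Fin n → Z, ‖walkTerm A H G z₀ ω‖ := by
        rw [Finset.mul_sum]; simp_rw [Finset.mul_sum]
    _ ≤ B * (c₀ * q ^ n) := mul_le_mul_of_nonneg_left (hW n) hB0

/-- **the `n`-step part of `G_k(s)` on `|s_□| ≤ R` (`R ≥ 1`)**: `‖Σ_{|ω|=n} s_ωG_{k,ω}‖ ≤ c₀(R^m·q)^n` — *"instead of
(CM^{−1})^n we have (C|s_□|M^{−1})^n"* with the exponent `m` of reading (iii). [cite: Dimock2013, §2.5 (arXiv:1108.1335v2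
TeX L1126–1130)] -/
theorem norm_level_le {c₀ q Rw : ℝ} (hW : WalkSumBound A H G c₀ q) {s : C → 𝕜} (hs : ∀ b, ‖s b‖ ≤ Rw) (hR : 1 ≤ Rw)
    {m : ℕ} (hm : ∀ z, (cubes z).card ≤ m) (n : ℕ) :
    ‖level A H G cubes s n‖ ≤ c₀ * (Rw ^ m * q) ^ n := by
  have h := norm_level_le_of_sω_le hW (pow_nonneg (by linarith) (m * n)) (fun ω => norm_sω_le_pow hs hR hm ω)
  calc ‖level A H G cubes s n‖ ≤ Rw ^ (m * n) * (c₀ * q ^ n) := h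
    _ = c₀ * (Rw ^ m * q) ^ n := by rw [mul_pow, ← pow_mul]; ring

/-- the same with `|s_□| ≤ 1`: the ratio `q` is unchanged (`‖Σ_{|ω|=n} s_ωG_{k,ω}‖ ≤ c₀q^n`). [cite: Dimock2013, §2.5
(arXiv:1108.1335v2 TeX L1106–1120)] -/
theorem norm_level_le_one {c₀ q : ℝ} (hW : WalkSumBound A H G c₀ q) {s : C → 𝕜} (hs : ∀ b, ‖s b‖ ≤ 1) (n : ℕ) :
    ‖level A H G cubes s n‖ ≤ c₀ * q ^ n := by
  have h := norm_level_le_of_sω_le (cubes := cubes) (n := n) hW zero_le_one (fun ω => norm_sω_le_one hs ω)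
  simpa using h

omit [DecidableEq C] in
/-- the constant of a walk-sum bound is nonnegative (the `n = 0` instance). [cite: Dimock2013, §2.4 (sonic)
(arXiv:1108.1335v2 TeX L1055–1064)] -/
theorem WalkSumBound.nonneg {c₀ q : ℝ} (hW : WalkSumBound A H G c₀ q) : 0 ≤ c₀ := by
  have h := hW 0
  simp only [pow_zero, mul_one] at h
  exact (Finset.sum_nonneg fun z₀ _ => Finset.sum_nonneg fun ω _ => norm_nonneg _).trans h

/-- from a geometric bound on the `n`-step parts, `G_k(s)` converges absolutely with the geometric-series bound.
[cite: Dimock2013, §2.5 (arXiv:1108.1335v2 TeX L1126–1130) and §2.4 (sonic) (TeX L1055–1064)] -/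
theorem summable_and_norm_Gs_le [CompleteSpace R] {c₀ r : ℝ} {s : C → 𝕜} (hr0 : 0 ≤ r) (hr : r < 1)
    (hc : ∀ n, ‖level A H G cubes s n‖ ≤ c₀ * r ^ n) :
    (Summable fun n => level A H G cubes s n) ∧ ‖Gs A H G cubes s‖ ≤ c₀ * (1 - r)⁻¹ := by
  have hg : Summable fun n => c₀ * r ^ n := (summable_geometric_of_lt_one hr0 hr).mul_left c₀
  have hnorm : Summable fun n => ‖level A H G cubes s n‖ :=
    Summable.of_nonneg_of_le (fun n => norm_nonneg _) hc hg
  refine ⟨hnorm.of_norm, ?_⟩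
  unfold Gs
  calc ‖∑' n, level A H G cubes s n‖ ≤ ∑' n, ‖level A H G cubes s n‖ := norm_tsum_le_tsum_norm hnorm
    _ ≤ ∑' n, c₀ * r ^ n := Summable.tsum_le_tsum hc hnorm hg
    _ = c₀ * (1 - r)⁻¹ := by rw [tsum_mul_left, tsum_geometric_of_lt_one hr0 hr]

/-- **ABSOLUTE CONVERGENCE of `G_k(s)` on `|s_□| ≤ R`** when `R^m·q < 1` (*"The random walk expansion still converges if M
is sufficiently large"*). [cite: Dimock2013, §2.5 (arXiv:1108.1335v2 TeX L1126–1130)] -/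
theorem summable_level [CompleteSpace R] {c₀ q Rw : ℝ} (hW : WalkSumBound A H G c₀ q) (hq : 0 ≤ q) {s : C → 𝕜}
    (hs : ∀ b, ‖s b‖ ≤ Rw) (hR : 1 ≤ Rw) {m : ℕ} (hm : ∀ z, (cubes z).card ≤ m) (hlt : Rw ^ m * q < 1) :
    Summable fun n => level A H G cubes s n :=
  (summable_and_norm_Gs_le (mul_nonneg (pow_nonneg (by linarith) m) hq) hlt (norm_level_le hW hs hR hm)).1

/-- **`‖G_k(s)‖ ≤ c₀(1 − R^m q)^{−1}`** on `|s_□| ≤ R` when `R^m·q < 1` (the bounds of `G_k` *"still hold for G_k(s)"*, here in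
the norm of the skeleton). [cite: Dimock2013, §2.5 (arXiv:1108.1335v2 TeX L1126–1130)] -/
theorem norm_Gs_le [CompleteSpace R] {c₀ q Rw : ℝ} (hW : WalkSumBound A H G c₀ q) (hq : 0 ≤ q) {s : C → 𝕜}
    (hs : ∀ b, ‖s b‖ ≤ Rw) (hR : 1 ≤ Rw) {m : ℕ} (hm : ∀ z, (cubes z).card ≤ m) (hlt : Rw ^ m * q < 1) :
    ‖Gs A H G cubes s‖ ≤ c₀ * (1 - Rw ^ m * q)⁻¹ :=
  (summable_and_norm_Gs_le (mul_nonneg (pow_nonneg (by linarith) m) hq) hlt (norm_level_le hW hs hR hm)).2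

/-- the case `|s_□| ≤ 1`: `G_k(s)` converges as soon as `q < 1`, `‖G_k(s)‖ ≤ c₀(1 − q)^{−1}` (the interpolation between `G_k`
and `G*_k`). [cite: Dimock2013, §2.5 (arXiv:1108.1335v2 TeX L1106–1120)] -/
theorem norm_Gs_le_one [CompleteSpace R] {c₀ q : ℝ} (hW : WalkSumBound A H G c₀ q) (hq : 0 ≤ q) {s : C → 𝕜}
    (hs : ∀ b, ‖s b‖ ≤ 1) (hlt : q < 1) : ‖Gs A H G cubes s‖ ≤ c₀ * (1 - q)⁻¹ :=
  (summable_and_norm_Gs_le hq hlt (norm_level_le_one (cubes := cubes) hW hs)).2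

/-! ## §4 The support restriction of the localization lemma (§4.5, L2410–2414) -/

/-- **"Thus in G_k(s)|_{s_{Z^c}=0} paths such that X_ω intersect Z^c do not occur, and we must have X_ω ⊂ Z"** (L2413–2414):
if `s_□ = 0` for every cube outside `Zset`, only the walks with `X_ω ⊆ Zset` contribute to each `n`-step part of `G_k(s)`.
[cite: Dimock2013, §4.5 (arXiv:1108.1335v2 TeX L2410–2416)] -/
theorem level_eq_sum_filter {s : C → 𝕜} {Zset : Finset C} (hs : ∀ b, b ∉ Zset → s b = 0) (n : ℕ) :
    level A H G cubes s n =
      ∑ z₀, ∑ ω ∈ Finset.univ.filter (fun ω : Fin n → Z => Xω cubes ω ⊆ Zset),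
        sω cubes s ω • walkTerm A H G z₀ ω := by
  unfold level
  refine Finset.sum_congr rfl fun z₀ _ => ?_
  rw [Finset.sum_filter]
  refine Finset.sum_congr rfl fun ω _ => ?_
  split_ifs with h
  · rfl
  · obtain ⟨b, hb, hbZ⟩ := Finset.not_subset.1 h
    rw [sω_eq_zero_of_mem hb (hs b hbZ), zero_smul]

end Weakened

/-! ## §5 The arithmetic of the complex domain `|s_□| ≤ M^α` -/

section Domain

/-- the convergence ratio on `|s_□| ≤ M^α` with `m` cubes per step and one-step size `M^{−1}`: `(M^α)^m·M^{−1} = M^{mα−1}`.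
[cite: Dimock2013, §2.5 (arXiv:1108.1335v2 TeX L1126–1130)] -/
theorem ratio_rpow_eq {M : ℝ} (hM : 0 < M) (α : ℝ) (m : ℕ) : (M ^ α) ^ m * M⁻¹ = M ^ ((m : ℝ) * α - 1) := by
  rw [← Real.rpow_natCast, ← Real.rpow_mul hM.le, ← Real.rpow_neg_one, ← Real.rpow_add hM]
  ring_nf

/-- **`mα < 1` ⟹ the ratio `c·(M^α)^m·M^{−1} → 0`** as `M → ∞`: on `|s_□| ≤ M^α` with `mα < 1` *"the random walk expansion
still converges if M is sufficiently large"* (with `m = 1` this is the printed `α = ½`; with the `m` of reading (iii) it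
asks `α < 1/m`). [cite: Dimock2013, §2.5 (arXiv:1108.1335v2 TeX L1126–1130)] -/
theorem ratio_tendsto_zero (c α : ℝ) {m : ℕ} (hα : (m : ℝ) * α < 1) :
    Tendsto (fun M : ℝ => c * ((M ^ α) ^ m * M⁻¹)) atTop (𝓝 0) := by
  have h1 : Tendsto (fun M : ℝ => M ^ (-(1 - (m : ℝ) * α))) atTop (𝓝 0) :=
    tendsto_rpow_neg_atTop (by linarith)
  have h2 : (fun M : ℝ => (M ^ α) ^ m * M⁻¹) =ᶠ[atTop] fun M => M ^ (-(1 - (m : ℝ) * α)) := by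
    filter_upwards [eventually_gt_atTop 0] with M hM
    rw [ratio_rpow_eq hM]; ring_nf
  have h3 : Tendsto (fun M : ℝ => (M ^ α) ^ m * M⁻¹) atTop (𝓝 0) := h1.congr' h2.symm
  simpa using h3.const_mul c

/-- `mα > 1`, `c > 0` ⟹ the ratio `c·(M^α)^m·M^{−1} → ∞` (e.g. `α = ½` with `m ≥ 3`): the per-cube count of reading (iii)
matters for the size of the complex domain, not for the real interpolation. [cite: Dimock2013, §2.5 (arXiv:1108.1335v2 TeX
L1126–1130)] -/
theorem ratio_tendsto_atTop {c α : ℝ} (hc : 0 < c) {m : ℕ} (hα : 1 < (m : ℝ) * α) :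
    Tendsto (fun M : ℝ => c * ((M ^ α) ^ m * M⁻¹)) atTop atTop := by
  have h1 : Tendsto (fun M : ℝ => M ^ ((m : ℝ) * α - 1)) atTop atTop := tendsto_rpow_atTop (by linarith)
  have h2 : (fun M : ℝ => (M ^ α) ^ m * M⁻¹) =ᶠ[atTop] fun M => M ^ ((m : ℝ) * α - 1) := by
    filter_upwards [eventually_gt_atTop 0] with M hM
    rw [ratio_rpow_eq hM]
  exact (h1.congr' h2.symm).const_mul_atTop hc

end Domain

end Literature.MathematicalPhysics.QuantumFieldTheory.Dimock2011to13.DecouplingWeights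

end
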